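import Literature.Geometry.Lorentzian.SpacetimePositiveMassRigidityReductionAnalytic
import HarnessLib

/-!
# The analytic half of the rigid positive energy theorem: zero ADM energy forces translational
# Killing initial data (named fact)

Companion of `SpacetimePositiveMassRigidity.lean` (the named fact
`positive_mass_rigidity_spacetime`: Beig–Chruściel, J. Math. Phys. 37 (1996) 1939–1961,
Thm. 4.1, case `m = 0`) and of `SpacetimePositiveMassRigidityReductionAnalytic.lean`, where the
GEOMETRIC half of the printed proof (§4) is proved:
`positive_mass_rigidity_spacetime_of_translationalKIDs` derives the fact from the existence of
four global translational Killing initial data with Minkowskian Gram matrix and bounded lapse.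
This file vendors that remaining input — the ANALYTIC half, Beig–Chruściel 1996, App. A with §4
(Witten's equation; Parker–Taubes 1982) — as the named fact
`beigChrusciel_translationalKIDs_of_admEnergy_zero : Prop` (D-0014), and records the resulting
conditional discharge `positive_mass_rigidity_spacetime_of_analyticHalf`. Nothing else is
proved here.

## The printed statements

Beig–Chruściel 1996, App. A ("Appendix A. The Witten argument"), for a data set as in Thm. 4.1
(compact interior, ends `≅ ℝ³ ∖ B(R_i)` with `|g − δ| + |r∂g| + |rK| ≤ C r^{−α}`, `α > 1/2`,
`√(g_ij JⁱJʲ) ≤ ρ ≤ C(1 + r)^{−3−ε}`): for every constant spinor `λ^∞` of the end there is a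
solution `λ` of the Witten equation asymptotic to it, and Witten's identity gives
`m |λ^∞|² ≥ 0`; **if `m = 0` then `λ` is parallel for the Sen connection (A.8)–(A.10), and the
pair `(N, Yⁱ)` built from `λ` solves the covariantly-constant (translational) Killing initial
data system (A.11)–(A.11.0), `DᵢYⱼ + N Kᵢⱼ = 0`, `DᵢN + KᵢⱼYʲ = 0`.** §4 (proof of Thm. 4.1):
the Killing developments of these KIDs carry "four linearly independent covariantly constant
vector fields `X_a`", `g(X_a, X_b) = η_{ab}`, asymptotic to the translations of the end, `X₀`
timelike future-directed.

## Hypotheses (those of the printed theorem, or stronger) — as for `positive_mass_rigidity_spacetime`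

dominant energy condition `|J|_h ≤ μ`; asymptotic flatness of order `1` on the end `e`
(`α = 1 > 1/2`, one more derivative); source decay `HasSourceDecay e D q₀`; `e.IsSoleEnd`
(compact interior, one end); `e.HasADMEnergy D 0` (`m = 0`). Orientability is not listed in
print (the spinorial argument runs on the orientation double cover otherwise, and KIDs descend,
being bilinear in the spinor).

## Conclusion (that of the printed argument, or weaker)

Global smooth `(N_a, Y_a)_{a<4}` on `X` solving the KID system for the data `(h, k)` in the
tree's conventions (`TranslationalKIDImmersion.lean`: `h(∇ᵥY_a, w) = −N_a k(v, w)`,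
`dN_a(v) = −k(v, Y_a)`; the sign of `k`, i.e. the time orientation, is immaterial: `(N, −Y)`
solve the system for `−k`), with Gram matrix `−N_aN_b + h(Y_a, Y_b) = η_{ab}` at every point
(it is constant on the connected `X`, `InitialDataSet.kidPairing_eq_of_isPreconnected`, and `η`
at infinity), `N₀ > 0` (the timelike KID is future-directed; `N₀² = 1 + |Y₀|² ≥ 1` never
vanishes), and `N₀` bounded above (continuous, and convergent to `1` along the end by the
asymptotics (A.8)/(A.3) of the Witten spinor). The weighted-Sobolev regularity and decay of
`(N_a, Y_a) − (translations)` proved in App. A are dropped.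

## Why this source / what it would take

No carrier in the tree: spinor bundle of an oriented Riemannian `3`-manifold (trivial, but via a
global frame or `w₂ = 0`), the Sen connection and the Sen–Witten operator, its Fredholm/isomorphism
theory between weighted Sobolev spaces on an asymptotically flat end (Bartnik 1986, §1–§2;
Parker–Taubes 1982, §4), Witten's boundary identity, and the algebra "parallel spinor ⟹ KID"
((A.11)). The rest of Thm. 4.1 is proved: `positive_mass_rigidity_spacetime_of_analyticHalf`.

## References

* R. Beig, P. T. Chruściel, *Killing vectors in asymptotically flat space-times. I.
  Asymptotically translational Killing vectors and the rigid positive energy theorem*, J. Math.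
  Phys. 37 (1996) 1939–1961, arXiv:gr-qc/9510015: Thm. 4.1, §4 (proof), App. A, (A.1)–(A.11).
  [BeigChrusciel1996]
* E. Witten, *A new proof of the positive energy theorem*, Comm. Math. Phys. 80 (1981) 381–402.
  [Witten1981]
* T. Parker, C. H. Taubes, *On Witten's proof of the positive energy theorem*, Comm. Math. Phys.
  84 (1982) 223–238, Thm. 4.3 and §4.
* R. Bartnik, *The mass of an asymptotically flat manifold*, CPAM 39 (1986) 661–693, §1–§2.
  [Bartnik1986]
-/

noncomputable section

open Bundle Set Function Manifold
open scoped Manifold ContDiff Topology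

namespace Literature.Geometry.Lorentzian

/-- **The analytic half of the rigid positive energy theorem** (named fact; Beig–Chruściel,
J. Math. Phys. 37 (1996), App. A with §4, case `m = 0`; Witten 1981, Parker–Taubes 1982):
*for a `3`-dimensional data set with compact interior and one asymptotically flat end,
`|g − δ| + |r∂g| + |rK| ≤ C r^{−α}` (`α > 1/2`), `√(g_ij JⁱJʲ) ≤ ρ ≤ C(1+r)^{−3−ε}`, whose ADM
mass vanishes, the solutions of Witten's equation asymptotic to the constant spinors are
Sen-parallel ((A.8)–(A.10)) and their bilinears `(N, Yⁱ)` solve the translational Killing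
initial data system (A.11)–(A.11.0), `DᵢYⱼ + N Kᵢⱼ = 0`, `DᵢN + KᵢⱼYʲ = 0`; there are four of
them, asymptotic to the translations `∂_a` of the end, with `g(X_a, X_b) = η_{ab}` (§4).* Here:
under the hypotheses of `positive_mass_rigidity_spacetime` (dominant energy condition,
asymptotic flatness of order `1`, source decay, sole end, `E_ADM = 0`) there are global smooth
`(N_a, Y_a)_{a<4}` with `h(∇ᵥY_a, w) = −N_a k(v, w)`, `dN_a(v) = −k(v, Y_a)`,
`−N_aN_b + h(Y_a, Y_b) = η_{ab}` everywhere, `N₀ > 0`, and `N₀` bounded above (the lapse is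
continuous and tends to `1` along the end). Granted this, the whole of Thm. 4.1 follows in the
tree (`positive_mass_rigidity_spacetime_of_analyticHalf`).
[cite: BeigChrusciel1996, App. A (A.8)–(A.11) and §4 (proof of Thm. 4.1), case m = 0] -/
def beigChrusciel_translationalKIDs_of_admEnergy_zero : Prop :=
  ∀ (X : Type) [TopologicalSpace X] [ChartedSpace E3 X] [IsManifold (𝓡 3) ∞ X]
    [T2Space X] [SecondCountableTopology X] [ConnectedSpace X]
    (D : InitialDataSet (𝓡 3) X) [D.metric.HasLeviCivita] (e : AFEnd X),
    D.SatisfiesDominantEnergyCondition → e.IsAsymptoticallyFlat D 1 →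
    (∃ q₀, HasSourceDecay e D q₀) → e.IsSoleEnd → e.HasADMEnergy D 0 →
    ∃ (N : Fin 4 → X → ℝ) (Y : Fin 4 → Π x : X, TangentSpace (𝓡 3) x),
      (∀ a, ContMDiff (𝓡 3) 𝓘(ℝ, ℝ) ∞ (N a)) ∧
      (∀ a, ContMDiff (𝓡 3) ((𝓡 3).prod (𝓡 3)) ∞
        fun x ↦ (TotalSpace.mk' E3 x (Y a x) : TangentBundle (𝓡 3) X)) ∧
      (∀ a (x : X) (v w : TangentSpace (𝓡 3) x),
        D.metric.val x (D.metric.leviCivita (Y a) x v) w = -(N a x * D.k x v w)) ∧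
      (∀ a (x : X) (v : TangentSpace (𝓡 3) x),
        mvfderiv (𝓡 3) (N a) x v = -(D.k x v (Y a x))) ∧
      (∀ (x : X) a b, -(N a x * N b x) + D.h.inner x (Y a x) (Y b x) =
        if a = b then (if a = 0 then -1 else 1) else 0) ∧
      (∀ x, 0 < N 0 x) ∧ ∃ C : ℝ, ∀ x, N 0 x ≤ C

/-- **The rigid positive energy theorem, granted its analytic half**: the named fact
`positive_mass_rigidity_spacetime` (Beig–Chruściel 1996, Thm. 4.1, `m = 0`) follows from
`beigChrusciel_translationalKIDs_of_admEnergy_zero` by the proved geometric half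
(`positive_mass_rigidity_spacetime_of_translationalKIDs`). [cite: BeigChrusciel1996, Thm. 4.1 and its proof, §4 and App. A] -/
theorem positive_mass_rigidity_spacetime_of_analyticHalf
    (hA : beigChrusciel_translationalKIDs_of_admEnergy_zero) : positive_mass_rigidity_spacetime :=
  positive_mass_rigidity_spacetime_of_translationalKIDs hA

end Literature.Geometry.Lorentzian

end
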